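import Literature.NumberTheory.Transcendental.KZLogCalculusProofs
import Literature.NumberTheory.Transcendental.KZMellinFibres
import Literature.NumberTheory.Transcendental.KZDominatedFamilyRelations
import Summits.KontsevichZagierPeriods.KontsevichZagierPeriods.Theorems.HurwitzMicroSectorsNormalFormPrincipleLevelOneExistsRep

/-!
# `NormalFormPrinciple` (stmt-KontsevichZagierPeriods-3869), line `SketchIdeator1` — leaf `stub_boxRigidity`,
# dimension two off the product type (`FiveZetaTwoOffProduct`): the integrability kit

The chain of KZ moves identifying `[(0,1)², 12/(1+x²+xy)]` with `[(0,1)², 5/(1−xy)]` passes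
through the unfolded "log monomials" `M(g, v) = [{0 < x < 1, 1 ≤ s ≤ v x}, g(x)/s]`, which are
integral representations only when `g log v` is absolutely integrable on `(0,1)`. We prove the
five instances used by the chain: `(1/x) log (1+x)`, `(1/x) log (1+x²)`, `(1/x) log (1+x+x²)` and
`(1/x) log ((1+x+x²)/(1+x²))` are measurable and bounded on `(0,1)` (via `0 ≤ log t ≤ t - 1` for
`t ≥ 1`), hence integrable on this set of finite measure; and for `k ≥ 1` the unbounded integrand
`(c/x) log (1/(1−xᵏ))` is dominated on `(0,1)` by `|c| (1 − log (1 − x))`, which is integrable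
because `log` is integrable at `0`. Pure Mathlib real analysis; no new definitions.
References: M. Kontsevich, D. Zagier, *Periods* (2001), §1.2.
-/

noncomputable section

open MeasureTheory Set
open Literature.NumberTheory.Transcendental Literature.NumberTheory.Transcendental.KZ
open Literature.ModelTheory.ExponentialFields (IsSemialgebraic)

namespace Summit.KontsevichZagierPeriods.HurwitzMicroSectors.NormalFormPrinciple.PiBox.M2

/-- A measurable real function which is bounded on `(0,1)` is integrable on `(0,1)`. -/
private theorem integrableOn_Ioo_of_abs_le {f : ℝ → ℝ} (hf : Measurable f) (M : ℝ)
    (hM : ∀ x ∈ Ioo (0:ℝ) 1, |f x| ≤ M) : IntegrableOn f (Ioo (0:ℝ) 1) :=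
  Measure.integrableOn_of_bounded (M := M) measure_Ioo_lt_top.ne hf.aestronglyMeasurable
    ((ae_restrict_iff' measurableSet_Ioo).2 (ae_of_all _ fun x hx => by
      simpa only [Real.norm_eq_abs] using hM x hx))

/-- The elementary bound behind the bounded cases: if `0 < x`, `1 ≤ v` and `v - 1 ≤ C x`, then
`|(1/x) log v| ≤ C` (from `0 ≤ log v ≤ v - 1`). -/
private theorem abs_one_div_mul_log_le {x v C : ℝ} (hx : 0 < x) (hv : 1 ≤ v)
    (hvC : v - 1 ≤ C * x) : |1 / x * Real.log v| ≤ C := by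
  have hlog0 : 0 ≤ Real.log v := Real.log_nonneg hv
  have hlog1 : Real.log v ≤ C * x := (Real.log_le_sub_one_of_pos (by linarith)).trans hvC
  rw [abs_of_nonneg (mul_nonneg (by positivity) hlog0)]
  calc 1 / x * Real.log v ≤ 1 / x * (C * x) := by gcongr
    _ = C := by field_simp

/-- The pointwise domination behind the unbounded case: for `0 < x < 1` and `k ≥ 1`,
`‖(c/x) log (1/(1 - xᵏ))‖ ≤ |c| (1 - log (1 - x))`. Indeed `0 ≤ -log (1 - xᵏ) ≤ -log (1 - x)`
(as `xᵏ ≤ x`), and `-log (1 - x) ≤ x/(1 - x)` gives `(1/x) (-log (1 - x)) ≤ 1 - log (1 - x)`. -/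
private theorem norm_div_mul_log_le {c x : ℝ} {k : ℕ} (hk : 1 ≤ k) (hx0 : 0 < x) (hx1 : x < 1) :
    ‖c / x * Real.log (1 / (1 - x ^ k))‖ ≤ |c| * (1 - Real.log (1 - x)) := by
  have hxk : x ^ k ≤ x := pow_le_of_le_one hx0.le hx1.le (by omega)
  have hxk0 : 0 < x ^ k := pow_pos hx0 k
  have h1 : 0 < 1 - x := by linarith
  have hLk0 : 0 ≤ -Real.log (1 - x ^ k) := by
    rw [neg_nonneg]
    exact Real.log_nonpos (by linarith) (by linarith)
  have hLkL : -Real.log (1 - x ^ k) ≤ -Real.log (1 - x) := by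
    rw [neg_le_neg_iff]
    exact Real.log_le_log h1 (by linarith)
  have hL0 : 0 ≤ -Real.log (1 - x) := hLk0.trans hLkL
  -- `-log (1 - x) ≤ x / (1 - x)`, i.e. `(-log (1 - x)) (1 - x) ≤ x`
  have hL1 : -Real.log (1 - x) * (1 - x) ≤ x := by
    have h := Real.log_le_sub_one_of_pos (inv_pos.2 h1)
    rw [Real.log_inv] at h
    calc -Real.log (1 - x) * (1 - x) ≤ ((1 - x)⁻¹ - 1) * (1 - x) :=
          mul_le_mul_of_nonneg_right h h1.le
      _ = x := by rw [sub_mul, inv_mul_cancel₀ h1.ne']; ring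
  have hkey : -Real.log (1 - x) / x ≤ 1 - Real.log (1 - x) := by
    rw [div_le_iff₀ hx0]
    nlinarith [hL1, hL0, hx0]
  rw [Real.norm_eq_abs, one_div, Real.log_inv, abs_mul, abs_div, abs_of_pos hx0,
    abs_of_nonneg hLk0]
  calc |c| / x * -Real.log (1 - x ^ k) ≤ |c| / x * -Real.log (1 - x) := by gcongr
    _ = |c| * (-Real.log (1 - x) / x) := by ring
    _ ≤ |c| * (1 - Real.log (1 - x)) := by gcongr

/-- **Integrability kit** for the `FiveZetaTwoOffProduct` chain: the logarithmic integrands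
`(1/x) log (1+x)`, `(1/x) log (1+x²)`, `(1/x) log (1+x+x²)`, `(1/x) log ((1+x+x²)/(1+x²))` and
`(c/x) log (1/(1−xᵏ))` (`k ≥ 1`) are absolutely integrable on `(0,1)`. The first four are bounded
measurable functions on a set of finite measure; the last is dominated by the integrable function
`|c| (1 − log (1 − x))`. [cite: KontsevichZagier2001, §1.2] -/
theorem integrable_logs :
    IntegrableOn (fun x : ℝ => (1 / x) * Real.log (1 + x)) (Set.Ioo (0:ℝ) 1) ∧
    IntegrableOn (fun x : ℝ => (1 / x) * Real.log (1 + x ^ 2)) (Set.Ioo (0:ℝ) 1) ∧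
    IntegrableOn (fun x : ℝ => (1 / x) * Real.log (1 + x + x ^ 2)) (Set.Ioo (0:ℝ) 1) ∧
    IntegrableOn (fun x : ℝ => (1 / x) * Real.log ((1 + x + x ^ 2) / (1 + x ^ 2))) (Set.Ioo (0:ℝ) 1) ∧
    (∀ (c : ℝ) (k : ℕ), 1 ≤ k →
      IntegrableOn (fun x : ℝ => (c / x) * Real.log (1 / (1 - x ^ k))) (Set.Ioo (0:ℝ) 1)) := by
  refine ⟨?_, ?_, ?_, ?_, ?_⟩
  · refine integrableOn_Ioo_of_abs_le (by fun_prop) 1 fun x hx => ?_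
    exact abs_one_div_mul_log_le hx.1 (by linarith [hx.1]) (by linarith)
  · refine integrableOn_Ioo_of_abs_le (by fun_prop) 1 fun x hx => ?_
    exact abs_one_div_mul_log_le hx.1 (by nlinarith [hx.1]) (by nlinarith [hx.1, hx.2])
  · refine integrableOn_Ioo_of_abs_le (by fun_prop) 2 fun x hx => ?_
    exact abs_one_div_mul_log_le hx.1 (by nlinarith [hx.1]) (by nlinarith [hx.1, hx.2])
  · refine integrableOn_Ioo_of_abs_le (by fun_prop) 1 fun x hx => ?_
    have h1 : 0 < 1 + x ^ 2 := by positivity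
    refine abs_one_div_mul_log_le hx.1 ?_ ?_
    · rw [le_div_iff₀ h1]
      nlinarith [hx.1]
    · rw [div_sub_one h1.ne', div_le_iff₀ h1]
      nlinarith [hx.1, sq_nonneg x]
  · intro c k hk
    have hlog : IntegrableOn (fun x : ℝ => Real.log (1 - x)) (Ioo (0:ℝ) 1) := by
      rw [← intervalIntegrable_iff_integrableOn_Ioo_of_le zero_le_one]
      simpa using (intervalIntegral.intervalIntegrable_log' (a := 1) (b := 0)).comp_sub_left 1
    have hF : IntegrableOn (fun x : ℝ => |c| * (1 - Real.log (1 - x))) (Ioo (0:ℝ) 1) :=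
      ((integrableOn_const measure_Ioo_lt_top.ne).sub hlog).const_mul |c|
    have hmeas : Measurable fun x : ℝ => c / x * Real.log (1 / (1 - x ^ k)) := by fun_prop
    refine Integrable.mono' hF hmeas.aestronglyMeasurable ?_
    exact (ae_restrict_iff' measurableSet_Ioo).2
      (ae_of_all _ fun x hx => norm_div_mul_log_le hk hx.1 hx.2)

end Summit.KontsevichZagierPeriods.HurwitzMicroSectors.NormalFormPrinciple.PiBox.M2
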